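import Literature.Probability.Percolation.TargetExploration
import HarnessLib

/-!
# The exploration stopped at a target set: halting, self-determination, correctness, splices

Proofs-only continuation of `TargetExploration.lean`
(the exploration of the open cluster of `o` among the edges `D`, revealing one boundary edge at a
time and stopping at the first vertex of the target set `A`; Gladkov, arXiv:2408.08457v2, §2 Def. 2.4 /
§6 Algorithm 2 with a target SET).  All proved:

* `halted_fin` — with fuel `#D + 1` the exploration has halted (a target is reached or the boundary
  is empty);
* `fin_congr`, **`selfDetermined_revealedAt`** — the final state depends on the configuration only
  through the revealed edges, so `K ↦ S(K)` is `DecisionTree.SelfDetermined` and Gladkov's swap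
  Lemma 3.1 (`DecisionTree.sum_pair_reindexW`, `Pr2W_preimage_swapPair`) applies to it;
* `mem_hit_iff_exists_conn` — **correctness**: for `K ⊆ D` a target is reached iff `o` is joined to
  some target by `K`-open edges; `eq_of_mem_hitAt` — at most one target is reached;
* `fin_splice`, `reachable_splice_of_mem_hitAt`, `exists_revealedClosed_of_reachable` — the splice
  `K →_S C₂` (equal to `K` on `S = S(K)`, to `C₂` elsewhere) explores like `K`, keeps the reached
  target joined to `o`, and any `C₂`-open path that is not open in the splice crosses an edge of the
  revealed CLOSED set `Z(K) = S(K) ∖ K`.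
-/

noncomputable section

open Classical

namespace Literature.Probability.Percolation

namespace TargetExploration

open Finset DecisionTree

variable {V : Type*} [Fintype V] [DecidableEq V]

section Revealed

variable {D : Finset (Sym2 V)} {A : Finset V} {o : V} {K : Finset (Sym2 V)}

/-! ### Halting and self-determination -/

/-- Either the run has halted by time `k`, or it has revealed at least `k` edges. [folklore] -/
theorem halted_or_le_card (K : Finset (Sym2 V)) :
    ∀ k, Halted D A (run D A o K k) ∨ k ≤ (run D A o K k).rev.card
  | 0 => Or.inr (Nat.zero_le _)
  | k + 1 => by
      by_cases h : Halted D A (run D A o K k)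
      · left; rw [run_succ, step_of_halted h]; exact h
      · rcases halted_or_le_card K k with h' | h'
        · exact absurd h' h
        · exact Or.inr (le_trans (Nat.add_le_add_right h' 1) (card_rev_step h))

/-- **The final state is halted**: a target is reached or the boundary is empty. [folklore] -/
theorem halted_fin (K : Finset (Sym2 V)) : Halted D A (fin D A o K) := by
  rcases halted_or_le_card (D := D) (A := A) (o := o) K (D.card + 1) with h | h
  · exact h
  · exact absurd ((card_le_card (inv_fin (D := D) (A := A) (o := o) K).rev_sub).trans_lt
      (Nat.lt_of_succ_le h)) (lt_irrefl _)

/-- A step depends on the configuration only through the edge it reveals. [folklore] -/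
theorem step_congr {K K' : Finset (Sym2 V)} {σ : St V}
    (h : ∀ e ∈ (step D A K σ).rev, (e ∈ K ↔ e ∈ K')) : step D A K' σ = step D A K σ := by
  by_cases hh : Halted D A σ
  · rw [step_of_halted hh, step_of_halted hh]
  obtain ⟨e, -, hpick, hstep⟩ := step_of_not_halted (K := K) hh
  obtain ⟨e', -, hpick', hstep'⟩ := step_of_not_halted (K := K') hh
  rw [hpick, Option.some.injEq] at hpick'
  subst hpick'
  have he : e ∈ (step D A K σ).rev := by
    rw [hstep]; split_ifs <;> exact mem_insert_self e σ.rev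
  have hiff := h e he
  rw [hstep', hstep]
  by_cases hK : e ∈ K
  · rw [if_pos hK, if_pos (hiff.1 hK)]
  · rw [if_neg hK, if_neg (fun h' => hK (hiff.2 h'))]

/-- The run depends on the configuration only through the revealed edges. [cite: Gladkov2024, §6.2] -/
theorem run_congr {K K' : Finset (Sym2 V)} :
    ∀ k, (∀ e ∈ (run D A o K k).rev, (e ∈ K ↔ e ∈ K')) → run D A o K' k = run D A o K k
  | 0, _ => rfl
  | k + 1, h => by
      have ih := run_congr k fun e he => h e (rev_subset_step K _ he)
      rw [run_succ, run_succ, ih]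
      exact step_congr h

/-- **Self-determination**: if `K'` agrees with `K` on the edges revealed by the exploration of
`K`, the two explorations end in the same state. [cite: Gladkov2024, Lemma 3.1 (S is built by a decision tree)] -/
theorem fin_congr {K K' : Finset (Sym2 V)} (h : ∀ e ∈ (fin D A o K).rev, (e ∈ K ↔ e ∈ K')) :
    fin D A o K' = fin D A o K := run_congr _ h

/-- The revealed-set map `K ↦ S(K)` is self-determined in the sense of `DecisionTreeBK.lean`, so
Gladkov's swap along it preserves the pair weights (`DecisionTree.sum_pair_reindexW`).
[cite: Gladkov2024, Lemma 3.1] -/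
theorem selfDetermined_revealedAt : SelfDetermined (revealedAt D A o) :=
  fun _ _ h => congrArg St.rev (fin_congr h)

/-! ### What the exploration decides -/

/-- A reached target certifies `o ↔ a` through open REVEALED edges. [folklore] -/
theorem reachable_revealed_of_mem_hitAt {a : V} (hK : K ∈ hitAt D A o a) :
    (openGraph (↑(revealedAt D A o K ∩ K) : Set (Sym2 V))).Reachable o a :=
  (inv_fin K).reach a hK.2

/-- A reached target is joined to `o`. [folklore] -/
theorem mem_conn_of_mem_hitAt {a : V} (hK : K ∈ hitAt D A o a) : K ∈ Gladkov.conn o a :=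
  (reachable_revealed_of_mem_hitAt hK).mono (openGraph_mono (coe_subset.2 inter_subset_right))

/-- `hit` is the union of the `hitAt a`, `a ∈ A`. [folklore] -/
theorem mem_hit_iff : K ∈ hit D A o ↔ ∃ a ∈ A, K ∈ hitAt D A o a := by
  simp only [hit, hitAt, Set.mem_setOf_eq, Finset.Nonempty, mem_inter]
  constructor
  · rintro ⟨a, ha, haA⟩; exact ⟨a, haA, haA, ha⟩
  · rintro ⟨a, haA, -, ha⟩; exact ⟨a, ha, haA⟩

/-- At most one target is reached: the events `hitAt a` are pairwise disjoint. [folklore] -/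
theorem eq_of_mem_hitAt {a a' : V} (ha : K ∈ hitAt D A o a) (ha' : K ∈ hitAt D A o a') : a = a' :=
  card_le_one.1 (inv_fin K).one a (mem_inter.2 ⟨ha.2, ha.1⟩) a' (mem_inter.2 ⟨ha'.2, ha'.1⟩)

/-- **Correctness**: if `o` is joined to a target by `K`-open edges (`K ⊆ D`), the exploration
reaches a target. [cite: Gladkov2024, §6.2 (abc ⊆ R_b ∪ R_c)] -/
theorem mem_hit_of_mem_conn (hKD : K ⊆ D) {a : V} (ha : a ∈ A) (hK : K ∈ Gladkov.conn o a) :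
    K ∈ hit D A o := by
  by_contra hnot
  set σ := fin D A o K with hσ
  have hinv : Inv D A o K σ := inv_fin K
  have hbnd : bnd D σ = ∅ := by
    rcases halted_fin (D := D) (A := A) (o := o) K with h | h
    · exact absurd h hnot
    · exact h
  have haσ : a ∉ σ.vis := fun h => hnot ⟨a, mem_inter.2 ⟨h, ha⟩⟩
  obtain ⟨w⟩ := (Gladkov.mem_conn.1 hK)
  obtain ⟨d, -, hd1, hd2⟩ := w.exists_boundary_dart (↑σ.vis) (mem_coe.2 hinv.root)
    (fun h => haσ (mem_coe.1 h))
  have hadj := d.adj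
  rw [openGraph_adj] at hadj
  obtain ⟨hmem, hne⟩ := hadj
  have hmemK : s(d.toProd.1, d.toProd.2) ∈ K := mem_coe.1 hmem
  have hnotrev : s(d.toProd.1, d.toProd.2) ∉ σ.rev := fun hrev =>
    hd2 (mem_coe.2 (hinv.open_vis _ hrev hmemK _ (Sym2.mem_mk_right _ _)))
  have hin : s(d.toProd.1, d.toProd.2) ∈ bnd D σ :=
    mem_bnd.2 ⟨⟨d.toProd.1, mem_coe.1 hd1, d.toProd.2, fun h => hd2 (mem_coe.2 h), rfl⟩,
      hKD hmemK, hnotrev⟩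
  rw [hbnd] at hin
  exact notMem_empty _ hin

/-- **The exploration decides `{o ↔ A}`**: for `K ⊆ D`, a target is reached iff `o` is joined to
some target by `K`-open edges. [folklore] -/
theorem mem_hit_iff_exists_conn (hKD : K ⊆ D) : K ∈ hit D A o ↔ ∃ a ∈ A, K ∈ Gladkov.conn o a := by
  constructor
  · intro h
    obtain ⟨a, ha, hKa⟩ := mem_hit_iff.1 h
    exact ⟨a, ha, mem_conn_of_mem_hitAt hKa⟩
  · rintro ⟨a, ha, hKa⟩
    exact mem_hit_of_mem_conn hKD ha hKa

/-! ### The spliced configuration `K →_S C₂` along the revealed set `S = S(K)` -/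

/-- The splice along the revealed set explores exactly like `K`. [cite: Gladkov2024, Lemma 3.1] -/
theorem fin_splice (K C₂ : Finset (Sym2 V)) :
    fin D A o (splice (revealedAt D A o K) K C₂) = fin D A o K :=
  fin_congr fun e he => (splice_agree _ K C₂ e he).symm

/-- In the splice, a reached target is still joined to `o` (the open revealed edges are kept).
[folklore] -/
theorem reachable_splice_of_mem_hitAt {a : V} (hK : K ∈ hitAt D A o a) (C₂ : Finset (Sym2 V)) :
    (openGraph (↑(splice (revealedAt D A o K) K C₂) : Set (Sym2 V))).Reachable o a := by
  refine (reachable_revealed_of_mem_hitAt hK).mono (openGraph_mono (coe_subset.2 ?_))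
  intro e he
  rw [mem_inter] at he
  exact (mem_splice_of_mem he.1).2 he.2

omit [Fintype V] [DecidableEq V] in
/-- A walk all of whose edges lie in `X` gives reachability in `openGraph X`. [folklore] -/
theorem reachable_of_walk_edges_subset {ω : Set (Sym2 V)} {X : Finset (Sym2 V)} {a b : V}
    (w : (openGraph ω).Walk a b) (h : ∀ e ∈ w.edges, e ∈ X) :
    (openGraph (↑X : Set (Sym2 V))).Reachable a b := by
  refine ⟨w.transfer _ fun e he => ?_⟩
  have h1 := w.edges_subset_edgeSet he
  rw [openGraph, SimpleGraph.edgeSet_fromEdgeSet] at h1 ⊢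
  exact ⟨mem_coe.2 (h e he), h1.2⟩

/-- **The revealed closed cut.** If `a ↔ x` in `C₂` but not in the splice `K →_S C₂`, some edge
revealed CLOSED by the exploration of `K` is open in `C₂`. [folklore] -/
theorem exists_revealedClosed_of_reachable {C₂ : Finset (Sym2 V)} {a x : V}
    (h₂ : (openGraph (↑C₂ : Set (Sym2 V))).Reachable a x)
    (hX : ¬ (openGraph (↑(splice (revealedAt D A o K) K C₂) : Set (Sym2 V))).Reachable a x) :
    ∃ e ∈ revealedClosed D A o K, e ∈ C₂ := by
  obtain ⟨w⟩ := h₂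
  by_contra hne
  push Not at hne
  refine hX (reachable_of_walk_edges_subset w fun e he => ?_)
  have heC : e ∈ C₂ := by
    have h1 := w.edges_subset_edgeSet he
    rw [openGraph, SimpleGraph.edgeSet_fromEdgeSet] at h1
    exact mem_coe.1 h1.1
  by_cases heF : e ∈ revealedAt D A o K
  · rw [mem_splice_of_mem heF]
    by_contra heK
    exact hne e (mem_sdiff.2 ⟨heF, heK⟩) heC
  · exact (mem_splice_of_not_mem heF).2 heC

end Revealed


end TargetExploration

end Literature.Probability.Percolation

end
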